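import Summits.ValiantsHypothesis.ValiantsHypothesis.Theorems.SymPencilPerFourInnerRankHypStar
import Summits.ValiantsHypothesis.ValiantsHypothesis.Theorems.SymPencilPerFourInnerRankNineHyperplane

/-!
# Route `SymPencil` — inner rank of the `2 | 2` row split of `per_4` on every `7`-dimensional
# subspace: **IR9U / IR9H hold; cell `(9, 7, 8)` of the size-`27` table is EMPTY**
# (`--supports` stmt-ValiantsHypothesis-5674 `SdcSuperquadratic`; rung currency only)

**Theorem** (`false_of_joint_family_on_seven`, `IR9U_holds`, `IR9H_holds`).  Over a field of
characteristic `0`, for every `7`-dimensional `U ≤ K⁴ × K⁴` there are no `c : ι → K` (`|ι| ≤ 9`)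
and bilinear `t_r` with `Σ_r c_r t_r(u, (y₂, y₃))² = per (u.1; u.2; y₂; y₃)` for all `u ∈ U`
and all `y₂, y₃ ∈ K⁴` — the inner rank of the `2 | 2` row split of `per_4` stays `≥ 10 > 8` on
every hyperplane of the `u`-side (equivalently, by `SymPencilPerFourInnerRankNineHyperplane`, of
the `y`-side).  Hence (`false_of_rank_nine_le_twentySeven`) the cell `(r, dim V, d) = (9, 7, 8)`
of `Cruxes/SdcSuperquadratic/CELLS-27.md` is empty UNCONDITIONALLY: plug `IR9U_holds` into
val-port-4's `SymPencilPerFourInnerRankNineHyperplane.false_of_rank_nine_le_twentySeven_of_IR9U`.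

PROOF (files `…InnerRankHypFamily/Pairs/Purity/Nine/Star`, this one).  (1) Reduce to non-zero
weights (`ι ↦ {r // c_r ≠ 0}`).  (2) WLOG some `(a₀, 0) ∉ U` (else some `(0, b₀) ∉ U` since
`dim U = 7 < 8`, and swap `a ↔ b`).  Then the second projection `U → K⁴` is onto
(its kernel embeds in `H_a = {a : (a,0) ∈ U} ≠ K⁴`), so it has a linear SECTION `ρ`
(`exists_section`); `dim H_a, dim H_b ≥ 3` (`three_le_finrank_comap_inl/inr`).  (3) At most one
coordinate `a_i` vanishes on `H_a`; move it (or `0`) to position `0` by a transposition of the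
columns (`hJ_perm_U`).  (4) `SymPencilPerFourInnerRankHypStar.false_of_star`.

Honest framing: this closes cell `(9, 7, 8)` only; cells `(8,8,10)`, `(11,5,4)`, `(12,4,2)` of the
size-`27` table remain; the window `27 ≤ sdc(per_4) ≤ 29` is UNCHANGED; the crux
`SdcSuperquadratic` (stmt-5674) stays OPEN; `VP ≠ VNP` is NOT proved and no summit statement is
proved here.  No definitions, no named facts. [folklore]
-/

noncomputable section

-- single-conjunct layout: Sub = Summit, duplicated namespace component intended
set_option linter.dupNamespace false

namespace Summit.ValiantsHypothesis.ValiantsHypothesis.Theorems.SymPencilPerFourInnerRankHypMain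

open Matrix Finset Module
open Summit.ValiantsHypothesis.ValiantsHypothesis.Theorems.SymPencilPerFourInnerRankRows
open Summit.ValiantsHypothesis.ValiantsHypothesis.Theorems.SymPencilPerFourInnerRankPairs
open Summit.ValiantsHypothesis.ValiantsHypothesis.Theorems.SymPencilPerFourInnerRankHypFamily
open Summit.ValiantsHypothesis.ValiantsHypothesis.Theorems.SymPencilPerFourInnerRankHypPairs
open Summit.ValiantsHypothesis.ValiantsHypothesis.Theorems.SymPencilPerFourInnerRankHypStar
open Summit.ValiantsHypothesis.ValiantsHypothesis.Theorems.SymPencilPerFourInnerRankNineHyperplane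

variable {K : Type*} [Field K] {ι : Type*} [Fintype ι]

/-! ### Dimension bookkeeping for a `7`-dimensional `U ≤ K⁴ × K⁴` -/

omit [Fintype ι] in
/-- `dim {a : (a, 0) ∈ U} ≥ 3` when `dim U = 7`. [folklore] -/
theorem three_le_finrank_comap_inl (U : Submodule K ((Fin 4 → K) × (Fin 4 → K)))
    (hU : finrank K U = 7) :
    3 ≤ finrank K (U.comap (LinearMap.inl K (Fin 4 → K) (Fin 4 → K))) := by
  set f := LinearMap.inl K (Fin 4 → K) (Fin 4 → K) with hf
  have hinj : Function.Injective f := LinearMap.inl_injective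
  have h1 : finrank K (U.comap f) = finrank K ((U.comap f).map f) :=
    LinearEquiv.finrank_eq (Submodule.equivMapOfInjective f hinj _)
  rw [h1, Submodule.map_comap_eq]
  have h2 := Submodule.finrank_sup_add_finrank_inf_eq (LinearMap.range f) U
  have h3 : finrank K (LinearMap.range f) = 4 := by
    rw [LinearMap.finrank_range_of_inj hinj, finrank_fintype_fun_eq_card, Fintype.card_fin]
  have h4 := Submodule.finrank_le (LinearMap.range f ⊔ U)
  rw [finrank_prod, finrank_fintype_fun_eq_card, Fintype.card_fin] at h4
  omega

omit [Fintype ι] in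
/-- `dim {b : (0, b) ∈ U} ≥ 3` when `dim U = 7`. [folklore] -/
theorem three_le_finrank_comap_inr (U : Submodule K ((Fin 4 → K) × (Fin 4 → K)))
    (hU : finrank K U = 7) :
    3 ≤ finrank K (U.comap (LinearMap.inr K (Fin 4 → K) (Fin 4 → K))) := by
  set f := LinearMap.inr K (Fin 4 → K) (Fin 4 → K) with hf
  have hinj : Function.Injective f := LinearMap.inr_injective
  have h1 : finrank K (U.comap f) = finrank K ((U.comap f).map f) :=
    LinearEquiv.finrank_eq (Submodule.equivMapOfInjective f hinj _)
  rw [h1, Submodule.map_comap_eq]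
  have h2 := Submodule.finrank_sup_add_finrank_inf_eq (LinearMap.range f) U
  have h3 : finrank K (LinearMap.range f) = 4 := by
    rw [LinearMap.finrank_range_of_inj hinj, finrank_fintype_fun_eq_card, Fintype.card_fin]
  have h4 := Submodule.finrank_le (LinearMap.range f ⊔ U)
  rw [finrank_prod, finrank_fintype_fun_eq_card, Fintype.card_fin] at h4
  omega

omit [Fintype ι] in
/-- **The section.**  If `dim U = 7` and some `(a₀, 0) ∉ U`, the second projection `U → K⁴` is
onto and has a linear section `ρ` with values in `U`. [folklore] -/
theorem exists_section (U : Submodule K ((Fin 4 → K) × (Fin 4 → K))) (hU : finrank K U = 7)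
    (a₀ : Fin 4 → K) (ha₀ : ((a₀, (0 : Fin 4 → K)) : (Fin 4 → K) × (Fin 4 → K)) ∉ U) :
    ∃ ρ : (Fin 4 → K) →ₗ[K] ((Fin 4 → K) × (Fin 4 → K)), (∀ b, (ρ b).2 = b) ∧ ∀ b, ρ b ∈ U := by
  set f : U →ₗ[K] (Fin 4 → K) := LinearMap.snd K (Fin 4 → K) (Fin 4 → K) ∘ₗ U.subtype with hf
  set Ha := U.comap (LinearMap.inl K (Fin 4 → K) (Fin 4 → K)) with hHa
  -- the kernel of `f` embeds into `H_a`, which is a proper subspace of `K⁴`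
  have hHa_lt : finrank K Ha < 4 := by
    have hne : ¬ Ha = ⊤ := fun h => ha₀ (by
      have : a₀ ∈ Ha := h ▸ Submodule.mem_top
      exact this)
    have h := Submodule.finrank_lt hne
    rwa [finrank_fintype_fun_eq_card, Fintype.card_fin] at h
  let g : LinearMap.ker f →ₗ[K] (Fin 4 → K) :=
    (LinearMap.fst K (Fin 4 → K) (Fin 4 → K) ∘ₗ U.subtype) ∘ₗ (LinearMap.ker f).subtype
  have hg : ∀ u : LinearMap.ker f, g u = (u : U).1.1 := fun u => rfl
  have hginj : Function.Injective g := by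
    intro u v huv
    have h2u : (u : U).1.2 = 0 := LinearMap.mem_ker.1 u.2
    have h2v : (v : U).1.2 = 0 := LinearMap.mem_ker.1 v.2
    rw [hg, hg] at huv
    exact Subtype.ext (Subtype.ext (Prod.ext huv (h2u.trans h2v.symm)))
  have hgrange : LinearMap.range g ≤ Ha := by
    rintro _ ⟨u, rfl⟩
    rw [hHa, Submodule.mem_comap, hg, LinearMap.inl_apply]
    have h2u : (u : U).1.2 = 0 := LinearMap.mem_ker.1 u.2
    have : ((u : U).1.1, (0 : Fin 4 → K)) = (u : U).1 := Prod.ext rfl h2u.symm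
    rw [this]; exact (u : U).2
  have hker : finrank K (LinearMap.ker f) ≤ 3 := by
    rw [← LinearMap.finrank_range_of_inj hginj]
    have := Submodule.finrank_mono hgrange
    omega
  have hrange : LinearMap.range f = ⊤ := by
    apply Submodule.eq_top_of_finrank_eq
    have h := LinearMap.finrank_range_add_finrank_ker f
    have hle := Submodule.finrank_le (LinearMap.range f)
    rw [finrank_fintype_fun_eq_card, Fintype.card_fin] at hle ⊢
    rw [hU] at h
    omega
  obtain ⟨g', hg'⟩ := LinearMap.exists_rightInverse_of_surjective f hrange
  refine ⟨U.subtype ∘ₗ g', fun b => ?_, fun b => (g' b).2⟩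
  have := LinearMap.congr_fun hg' b
  exact this

/-! ### The core: a missing point `(a₀, 0)` -/

/-- **Core lemma.**  `hJ` on a `7`-dimensional `U` with all weights non-zero, `|ι| ≤ 9`, and some
`(a₀, 0) ∉ U` is impossible. [folklore] -/
theorem false_of_not_mem [CharZero K] [DecidableEq ι] (hι : Fintype.card ι ≤ 9) (c : ι → K)
    (hc : ∀ r, c r ≠ 0)
    (t : ι → (((Fin 4 → K) × (Fin 4 → K)) →ₗ[K] ((Fin 4 → K) × (Fin 4 → K)) →ₗ[K] K))
    (U : Submodule K ((Fin 4 → K) × (Fin 4 → K))) (hU : finrank K U = 7)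
    (hJ : ∀ u ∈ U, ∀ y₂ y₃ : Fin 4 → K,
      ∑ r, c r * (t r u (y₂, y₃)) ^ 2 = (Matrix.of ![u.1, u.2, y₂, y₃]).permanent)
    (a₀ : Fin 4 → K) (ha₀ : ((a₀, (0 : Fin 4 → K)) : (Fin 4 → K) × (Fin 4 → K)) ∉ U) : False := by
  obtain ⟨ρ, hρ2, hρU⟩ := exists_section U hU a₀ ha₀
  have hUa := three_le_finrank_comap_inl U hU
  set Ha := U.comap (LinearMap.inl K (Fin 4 → K) (Fin 4 → K)) with hHa
  have hmemA : ∀ a, a ∈ Ha ↔ ((a, (0 : Fin 4 → K)) : (Fin 4 → K) × (Fin 4 → K)) ∈ U :=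
    fun a => Submodule.mem_comap
  -- at most one coordinate vanishes on `H_a`; call it `i₀` (or `0`)
  obtain ⟨i₀, hi₀⟩ : ∃ i₀ : Fin 4, ∀ i, i ≠ i₀ → ∃ a : Fin 4 → K,
      ((a, (0 : Fin 4 → K)) : (Fin 4 → K) × (Fin 4 → K)) ∈ U ∧ a i ≠ 0 := by
    by_cases hex : ∃ i₀ : Fin 4, ∀ a : Fin 4 → K,
        ((a, (0 : Fin 4 → K)) : (Fin 4 → K) × (Fin 4 → K)) ∈ U → a i₀ = 0
    · obtain ⟨i₀, h₀⟩ := hex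
      refine ⟨i₀, fun i hi => ?_⟩
      by_contra hne
      push Not at hne
      have := finrank_le_two_of_two_functionals Ha (LinearMap.proj i) (LinearMap.proj i₀)
        (fun a ha => hne a ((hmemA a).1 ha)) (fun a ha => h₀ a ((hmemA a).1 ha))
        (Pi.single i 1) (Pi.single i₀ 1) (by simp) (by simp [hi]) (by simp [Ne.symm hi]) (by simp)
      omega
    · push Not at hex
      exact ⟨0, fun i _ => hex i⟩
  -- transport along the transposition `π = (0 i₀)`
  set π : Equiv.Perm (Fin 4) := Equiv.swap 0 i₀ with hπ
  have hπs : π.symm = π := by rw [hπ, Equiv.symm_swap]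
  set P := ((LinearEquiv.funCongrLeft K K π).prodCongr (LinearEquiv.funCongrLeft K K π)).toLinearMap
    with hP
  set Pσ := ((LinearEquiv.funCongrLeft K K π.symm).prodCongr
    (LinearEquiv.funCongrLeft K K π.symm)).toLinearMap with hPσ
  have hPP : ∀ x, P (Pσ x) = x := prodCongr_funCongrLeft_symm_apply π
  set t' : ι → (((Fin 4 → K) × (Fin 4 → K)) →ₗ[K] ((Fin 4 → K) × (Fin 4 → K)) →ₗ[K] K) :=
    fun r => (t r).compl₁₂ P P with ht'
  set U' := U.comap P with hU'
  have hmemU' : ∀ x, x ∈ U' ↔ P x ∈ U := fun x => Submodule.mem_comap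
  have hJ' := hJ_perm_U c t U hJ π
  set ρ' : (Fin 4 → K) →ₗ[K] ((Fin 4 → K) × (Fin 4 → K)) :=
    Pσ ∘ₗ ρ ∘ₗ (LinearEquiv.funCongrLeft K K π).toLinearMap with hρ'
  have hρ'P : ∀ b, P (ρ' b) = ρ (b ∘ π) := fun b => hPP _
  have hρ'2 : ∀ b, (ρ' b).2 = b := fun b => by
    change (ρ (b ∘ π)).2 ∘ π.symm = b
    rw [hρ2]
    funext m; simp
  have hρ'U : ∀ b, ρ' b ∈ U' := fun b => by
    rw [hmemU', hρ'P]; exact hρU _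
  -- `H_a`, `H_b` of `U'` are the transported ones
  have hUa' : 3 ≤ finrank K (U'.comap (LinearMap.inl K (Fin 4 → K) (Fin 4 → K))) := by
    have e : U'.comap (LinearMap.inl K (Fin 4 → K) (Fin 4 → K)) =
        (U.comap (LinearMap.inl K (Fin 4 → K) (Fin 4 → K))).comap
          (LinearEquiv.funCongrLeft K K π).toLinearMap := by
      ext a
      simp only [Submodule.mem_comap, LinearMap.inl_apply, LinearEquiv.coe_coe]
      change ((a ∘ π, (0 : Fin 4 → K) ∘ π) : (Fin 4 → K) × (Fin 4 → K)) ∈ U ↔ _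
      rfl
    rw [e, Submodule.comap_equiv_eq_map_symm, LinearEquiv.finrank_map_eq]
    exact hUa
  have hUb' : 3 ≤ finrank K (U'.comap (LinearMap.inr K (Fin 4 → K) (Fin 4 → K))) := by
    have e : U'.comap (LinearMap.inr K (Fin 4 → K) (Fin 4 → K)) =
        (U.comap (LinearMap.inr K (Fin 4 → K) (Fin 4 → K))).comap
          (LinearEquiv.funCongrLeft K K π).toLinearMap := by
      ext b
      simp only [Submodule.mem_comap, LinearMap.inr_apply, LinearEquiv.coe_coe]
      change ((((0 : Fin 4 → K) ∘ π), b ∘ π) : (Fin 4 → K) × (Fin 4 → K)) ∈ U ↔ _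
      rfl
    rw [e, Submodule.comap_equiv_eq_map_symm, LinearEquiv.finrank_map_eq]
    exact three_le_finrank_comap_inr U hU
  have hH' : ∀ i : Fin 4, i ≠ 0 → ∃ a : Fin 4 → K,
      ((a, (0 : Fin 4 → K)) : (Fin 4 → K) × (Fin 4 → K)) ∈ U' ∧ a i ≠ 0 := by
    intro i hi
    have hπi : π i ≠ i₀ := by
      intro h
      have : i = π.symm i₀ := (Equiv.eq_symm_apply π).2 h
      rw [hπs, hπ, Equiv.swap_apply_right] at this
      exact hi this
    obtain ⟨a, ha, hai⟩ := hi₀ (π i) hπi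
    refine ⟨a ∘ π, ?_, hai⟩
    rw [hmemU']
    change (((a ∘ π) ∘ π, (0 : Fin 4 → K) ∘ π) : (Fin 4 → K) × (Fin 4 → K)) ∈ U
    have : (a ∘ π) ∘ π = a := by
      funext m
      simp only [Function.comp_apply]
      rw [show π (π m) = m from by rw [hπ]; exact Equiv.swap_apply_self _ _ _]
    rw [this]; exact ha
  exact false_of_star hι c hc t' U' hJ' ρ' hρ'2 hρ'U hUa' hUb' hH'

/-! ### The theorem -/

/-- **No joint family on a `7`-dimensional `U` (all weights non-zero, `|ι| ≤ 9`).** [folklore] -/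
theorem false_of_joint_family_on_seven' [CharZero K] [DecidableEq ι] (hι : Fintype.card ι ≤ 9)
    (c : ι → K) (hc : ∀ r, c r ≠ 0)
    (t : ι → (((Fin 4 → K) × (Fin 4 → K)) →ₗ[K] ((Fin 4 → K) × (Fin 4 → K)) →ₗ[K] K))
    (U : Submodule K ((Fin 4 → K) × (Fin 4 → K))) (hU : finrank K U = 7)
    (hJ : ∀ u ∈ U, ∀ y₂ y₃ : Fin 4 → K,
      ∑ r, c r * (t r u (y₂, y₃)) ^ 2 = (Matrix.of ![u.1, u.2, y₂, y₃]).permanent) : False := by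
  by_cases hA : ∀ a : Fin 4 → K, ((a, (0 : Fin 4 → K)) : (Fin 4 → K) × (Fin 4 → K)) ∈ U
  · -- then some `(0, b₀) ∉ U`: swap `a ↔ b`
    have hB : ∃ b₀ : Fin 4 → K, (((0 : Fin 4 → K), b₀) : (Fin 4 → K) × (Fin 4 → K)) ∉ U := by
      by_contra hne
      push Not at hne
      have htop : U = ⊤ := by
        refine eq_top_iff.2 fun u _ => ?_
        have : u = (u.1, 0) + (0, u.2) := by ext <;> simp
        rw [this]; exact U.add_mem (hA u.1) (hne u.2)
      rw [htop, finrank_top, finrank_prod, finrank_fintype_fun_eq_card, Fintype.card_fin] at hU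
      omega
    obtain ⟨b₀, hb₀⟩ := hB
    set S := (LinearEquiv.prodComm K (Fin 4 → K) (Fin 4 → K)).toLinearMap with hS
    have hU' : finrank K (U.comap S) = 7 := by
      rw [hS, Submodule.comap_equiv_eq_map_symm, LinearEquiv.finrank_map_eq, hU]
    refine false_of_not_mem hι c hc _ (U.comap S) hU' (hJ_swap_U c t U hJ) b₀ ?_
    rw [Submodule.mem_comap]
    exact hb₀
  · push Not at hA
    obtain ⟨a₀, ha₀⟩ := hA
    exact false_of_not_mem hι c hc t U hU hJ a₀ ha₀

/-- **No joint family on a `7`-dimensional `U`, `|ι| ≤ 9`** (arbitrary weights: drop the zero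
ones). [folklore] -/
theorem false_of_joint_family_on_seven [CharZero K] (hι : Fintype.card ι ≤ 9) (c : ι → K)
    (t : ι → (((Fin 4 → K) × (Fin 4 → K)) →ₗ[K] ((Fin 4 → K) × (Fin 4 → K)) →ₗ[K] K))
    (U : Submodule K ((Fin 4 → K) × (Fin 4 → K))) (hU : finrank K U = 7)
    (hJ : ∀ u ∈ U, ∀ y₂ y₃ : Fin 4 → K,
      ∑ r, c r * (t r u (y₂, y₃)) ^ 2 = (Matrix.of ![u.1, u.2, y₂, y₃]).permanent) : False := by
  classical
  let ι' := {r : ι // c r ≠ 0}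
  have hι' : Fintype.card ι' ≤ 9 := (Fintype.card_subtype_le _).trans hι
  refine false_of_joint_family_on_seven' hι' (fun r : ι' => c r.1) (fun r => r.2)
    (fun r => t r.1) U hU fun u hu y₂ y₃ => ?_
  have h : ∑ r ∈ Finset.univ.filter (fun r => c r ≠ 0), c r * (t r u (y₂, y₃)) ^ 2 =
      ∑ r : ι', c r.1 * (t r.1 u (y₂, y₃)) ^ 2 :=
    Finset.sum_subtype _ (fun r => by simp) _
  rw [← hJ u hu y₂ y₃, ← h]
  exact Finset.sum_filter_of_ne fun r _ hr hc0 => hr (by rw [hc0, zero_mul])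

/-- **IR9U holds**: the inner rank of the `2 | 2` row split of `per_4` is `≥ 9` on every
`7`-dimensional subspace of the `u`-side (exact hypothesis format of
`SymPencilPerFourInnerRankNineHyperplane.false_of_rank_nine_le_twentySeven_of_IR9U`). [folklore] -/
theorem IR9U_holds (K : Type*) [Field K] [CharZero K] :
    ∀ U' : Submodule K ((Fin 4 → K) × (Fin 4 → K)), finrank K U' = 7 →
      ∀ (c : Fin 8 → K)
        (t : Fin 8 → (((Fin 4 → K) × (Fin 4 → K)) →ₗ[K] ((Fin 4 → K) × (Fin 4 → K)) →ₗ[K] K)),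
      ¬ (∀ u ∈ U', ∀ y₂ y₃ : Fin 4 → K,
          ∑ r, c r * (t r u (y₂, y₃)) ^ 2 = (Matrix.of ![u.1, u.2, y₂, y₃]).permanent) :=
  fun U' hU c t hJ => false_of_joint_family_on_seven (by simp) c t U' hU hJ

/-- **IR9H holds**: the same with the restriction on the `y`-side (exact hypothesis format of
`SymPencilSdcPerFourCellNineSevenSplit.false_of_rank_nine_le_twentySeven_of_IR9H`). [folklore] -/
theorem IR9H_holds (K : Type*) [Field K] [CharZero K] :
    ∀ V' : Submodule K ((Fin 4 → K) × (Fin 4 → K)), finrank K V' = 7 →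
      ∀ (c : Fin 8 → K)
        (t : Fin 8 → (((Fin 4 → K) × (Fin 4 → K)) →ₗ[K] ((Fin 4 → K) × (Fin 4 → K)) →ₗ[K] K)),
      ¬ (∀ a b : Fin 4 → K, ∀ y ∈ V',
          ∑ r, c r * (t r (a, b) y) ^ 2 = (Matrix.of ![a, b, y.1, y.2]).permanent) :=
  IR9H_of_IR9U (IR9U_holds K)

/-- **Nine squares do not suffice either** on a `7`-dimensional subspace of the `u`-side (inner
rank `≥ 10` there). [folklore] -/
theorem no_nine_squares_on_seven (K : Type*) [Field K] [CharZero K]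
    (U' : Submodule K ((Fin 4 → K) × (Fin 4 → K))) (hU : finrank K U' = 7) (c : Fin 9 → K)
    (t : Fin 9 → (((Fin 4 → K) × (Fin 4 → K)) →ₗ[K] ((Fin 4 → K) × (Fin 4 → K)) →ₗ[K] K)) :
    ¬ (∀ u ∈ U', ∀ y₂ y₃ : Fin 4 → K,
        ∑ r, c r * (t r u (y₂, y₃)) ^ 2 = (Matrix.of ![u.1, u.2, y₂, y₃]).permanent) :=
  fun hJ => false_of_joint_family_on_seven (by simp) c t U' hU hJ

/-- **Cell `(9, 7, 8)` of the size-`27` table is EMPTY** (unconditional form of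
`SymPencilPerFourInnerRankNineHyperplane.false_of_rank_nine_le_twentySeven_of_IR9U`): no symmetric
affine determinantal package of `per_4` of size `m ≤ 27` with `rank bL = 9`.  Rung currency:
stmt-5674 stays open; the window `27 ≤ sdc(per_4) ≤ 29` is unchanged by this alone. [folklore] -/
theorem false_of_rank_nine_le_twentySeven (K : Type*) [Field K] [CharZero K]
    {m : ℕ} (hm : m ≤ 27)
    {i₀ : Fin m} {D : Matrix {i // i ≠ i₀} {i // i ≠ i₀} K}
    {bL : (Fin 4 × Fin 4 → K) →ₗ[K] ({i // i ≠ i₀} → K)}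
    {CL : (Fin 4 × Fin 4 → K) →ₗ[K] Matrix {i // i ≠ i₀} {i // i ≠ i₀} K} {κ : K}
    (hD : IsUnit D.det) (hDs : Dᵀ = D) (hCs : ∀ z, (CL z)ᵀ = CL z) (hκ : κ ≠ 0)
    (hi : ∀ z, bL z ⬝ᵥ D⁻¹ *ᵥ bL z = 0)
    (hii : ∀ z, bL z ⬝ᵥ (D⁻¹ * CL z * D⁻¹) *ᵥ bL z = 0)
    (hiii : ∀ z, D.det * (bL z ⬝ᵥ (D⁻¹ * CL z * D⁻¹ * CL z * D⁻¹) *ᵥ bL z) =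
      -(κ * MvPolynomial.eval z (Literature.Computability.AlgebraicComplexity.perPoly (Fin 4) K)))
    (hV4 : ∀ x ∈ LinearMap.ker bL, ∀ r c : Fin 4,
      ((Matrix.of fun i j => x (i, j)).submatrix r.succAbove c.succAbove).permanent = 0)
    (hcard : Fintype.card {i // i ≠ i₀} + 1 = m)
    (hrn : finrank K (LinearMap.range bL) + finrank K (LinearMap.ker bL) = 16)
    (h9 : finrank K (LinearMap.range bL) = 9) : False :=
  false_of_rank_nine_le_twentySeven_of_IR9U K (IR9U_holds K) hm hD hDs hCs hκ hi hii hiii hV4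
    hcard hrn h9

end Summit.ValiantsHypothesis.ValiantsHypothesis.Theorems.SymPencilPerFourInnerRankHypMain

end
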